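import Summits.CriticalPhenomena.PercolationContinuityZ3.Theorems.PercNearOneGluingNoHeavyLowerTailThreeSumClosure
import Summits.CriticalPhenomena.PercolationContinuityZ3.Theorems.PercNearOneGluingNoHeavyLowerTailThreeSumAtoms
import Summits.CriticalPhenomena.PercolationContinuityZ3.Theorems.PercNearOneGluingNoHeavyLowerTailThreeSumClaw
import HarnessLib

/-!
# `NoHeavyLowerTail` (stmt-CriticalPhenomena-4575) — the 3-sum theorem for R1, measure level, part 10:
# **R1-RC ON `K_{3,n}` FOR EVERY `q > 0`** (the first kernel instance of R1 for `φ_{𝐩,q}`, `q ≠ 1`, on an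
# infinite — and non-planar — family)

Support file (prover prim-gen-kcluster gen 71; `--supports stmt-CriticalPhenomena-4575`).  No definitions, no
named facts, no sorries.

`K_{3,n}` with `{a, b, c}` the side of size three is the 3-sum along `{a,b,c}` of `n` claws.  By part 9 each
claw satisfies the rows R1, LB, LG of the instance `(a; b, c)` under its free random-cluster measure (any
`q > 0`, any parameters), and by parts 6–7 the triple (R1, LB, LG) is preserved under gluing along `{a,b,c}`.
Induction on the set of centres:

* **`ThreeSum.kThreeN_rows`** — for a finite vertex type `V`, distinct `a, b, c`, a finite set `C` of centres
  avoiding `a, b, c`, parameters `w` vanishing off the claw pairs `{s(v,a), s(v,b), s(v,c) : v ∈ C}` and any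
  `q > 0`: the free random-cluster measure `rcMeasureW w q ∅` satisfies R1 `φ(T)φ(S) ≤ φ(U_b)φ(U_c)`, LB and
  LG (support = the claw pairs) — i.e. **R1-RC holds on every `K_{3,n}`** (apex and terminals on the 3-side),
  for EVERY `q > 0` and all edge parameters (sub-claws with some parameters `0` included).
* `ThreeSum.kThreeN_r1` — the R1 row alone.
(Memo KCLUSTER-gen69 §6 (C1) listed `K_{3,n}` among the `q ≥ 1` corollaries of the paper 3-sum theorem; here it
is kernel and for all `q > 0`.)
-/

noncomputable section

namespace Summit.CriticalPhenomena.PercolationContinuityZ3.Theorems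

namespace ThreeSum

open Finset SimpleGraph Literature.Probability.Percolation Literature.Probability.Percolation.Gladkov
open Literature.Probability.Percolation.BHK2006 (weight)
open Literature.Probability.Percolation.DecisionTree (ind ind_of_mem ind_of_not_mem ind_nonneg)
open Literature.Probability.LatticeModels RefinedRowR3 ThreePointLB MeasureTheory
open scoped Classical

variable {V : Type*} [Fintype V]

section KThreeN

variable {a b c : V} (hab : a ≠ b) (hac : a ≠ c) (hbc : b ≠ c) {q : ℝ} (hq : 0 < q)
include hab hac hbc hq

/-- **R1, LB, LG on `K_{3,n}` (all claws on `{a,b,c}` with centres in `C`), every `q > 0`.** [this work] -/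
theorem kThreeN_rows (C : Finset V) (haC : a ∉ C) (hbC : b ∉ C) (hcC : c ∉ C) (w : Sym2 V → unitInterval)
    (hw : ∀ e, e ∉ (C.biUnion fun v => ({s(v, a), s(v, b), s(v, c)} : Finset (Sym2 V))) → (w e : ℝ) = 0) :
    ((rcMeasureW w q ∅).real {η : BondConfig V | b ∈ cl η.toFinset a ∧ c ∈ cl η.toFinset a} * (rcMeasureW w q ∅).real {η : BondConfig V | b ∉ cl η.toFinset a ∧ c ∉ cl η.toFinset a ∧ Sep (C.biUnion fun v => ({s(v, a), s(v, b), s(v, c)} : Finset (Sym2 V))) (cl η.toFinset a) b c} ≤ (rcMeasureW w q ∅).real {η : BondConfig V | b ∈ cl η.toFinset a ∧ c ∉ cl η.toFinset a} * (rcMeasureW w q ∅).real {η : BondConfig V | b ∉ cl η.toFinset a ∧ c ∈ cl η.toFinset a}) ∧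
      ((rcMeasureW w q ∅).real {η : BondConfig V | b ∉ cl η.toFinset a ∧ c ∉ cl η.toFinset a ∧ Sep (C.biUnion fun v => ({s(v, a), s(v, b), s(v, c)} : Finset (Sym2 V))) (cl η.toFinset a) b c} * (rcMeasureW w q ∅).real {η : BondConfig V | b ∉ cl η.toFinset a ∧ c ∉ cl η.toFinset a ∧ c ∈ cl η.toFinset b} ≤ (rcMeasureW w q ∅).real {η : BondConfig V | b ∉ cl η.toFinset a ∧ c ∉ cl η.toFinset a ∧ c ∉ cl η.toFinset b ∧ ¬ Sep (C.biUnion fun v => ({s(v, a), s(v, b), s(v, c)} : Finset (Sym2 V))) (cl η.toFinset a) b c} * (rcMeasureW w q ∅).real {η : BondConfig V | b ∈ cl η.toFinset a ∧ c ∉ cl η.toFinset a}) ∧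
      ((rcMeasureW w q ∅).real {η : BondConfig V | b ∉ cl η.toFinset a ∧ c ∉ cl η.toFinset a ∧ Sep (C.biUnion fun v => ({s(v, a), s(v, b), s(v, c)} : Finset (Sym2 V))) (cl η.toFinset a) b c} * (rcMeasureW w q ∅).real {η : BondConfig V | b ∉ cl η.toFinset a ∧ c ∉ cl η.toFinset a ∧ c ∈ cl η.toFinset b} ≤ (rcMeasureW w q ∅).real {η : BondConfig V | b ∉ cl η.toFinset a ∧ c ∉ cl η.toFinset a ∧ c ∉ cl η.toFinset b ∧ ¬ Sep (C.biUnion fun v => ({s(v, a), s(v, b), s(v, c)} : Finset (Sym2 V))) (cl η.toFinset a) b c} * (rcMeasureW w q ∅).real {η : BondConfig V | b ∉ cl η.toFinset a ∧ c ∈ cl η.toFinset a}) := by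
  induction C using Finset.induction_on generalizing w with
  | empty =>
    -- empty support: `T` and `U_a` are null
    have hw0 : ∀ e, e ∉ ((∅ : Finset (Sym2 V)) : Set (Sym2 V)) → (w e : ℝ) = 0 := fun e _ =>
      hw e (by simp)
    have hT : (rcMeasureW w q ∅).real {η : BondConfig V | b ∈ cl η.toFinset a ∧ c ∈ cl η.toFinset a} = 0 := by
      refine real_eq_zero_of_support w hq hw0 fun ω hω hωT => hab ?_
      have h0 : ω = ∅ := Set.subset_empty_iff.1 (by simpa using hω)
      obtain ⟨e, he, _⟩ := APL.exists_mem_edge_of_mem_cl hωT.1 hab.symm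
      rw [mem_toFinset', h0] at he
      exact he.elim
    have hN : (rcMeasureW w q ∅).real {η : BondConfig V | b ∉ cl η.toFinset a ∧ c ∉ cl η.toFinset a ∧ c ∈ cl η.toFinset b} = 0 := by
      refine real_eq_zero_of_support w hq hw0 fun ω hω hωN => hbc ?_
      have h0 : ω = ∅ := Set.subset_empty_iff.1 (by simpa using hω)
      obtain ⟨e, he, _⟩ := APL.exists_mem_edge_of_mem_cl hωN.2.2 hbc.symm
      rw [mem_toFinset', h0] at he
      exact he.elim
    rw [Finset.biUnion_empty, hT, hN, zero_mul, mul_zero]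
    exact ⟨mul_nonneg measureReal_nonneg measureReal_nonneg, mul_nonneg measureReal_nonneg measureReal_nonneg,
      mul_nonneg measureReal_nonneg measureReal_nonneg⟩
  | insert v C hvC ih =>
    -- glue the claw at `v` (piece B) to the claws with centres in `C` (piece A)
    have hva : v ≠ a := fun h => haC (h ▸ Finset.mem_insert_self v C)
    have hvb : v ≠ b := fun h => hbC (h ▸ Finset.mem_insert_self v C)
    have hvc : v ≠ c := fun h => hcC (h ▸ Finset.mem_insert_self v C)
    have haC' : a ∉ C := fun h => haC (Finset.mem_insert_of_mem h)
    have hbC' : b ∉ C := fun h => hbC (Finset.mem_insert_of_mem h)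
    have hcC' : c ∉ C := fun h => hcC (Finset.mem_insert_of_mem h)
    set DA : Finset (Sym2 V) := (C.biUnion fun v => ({s(v, a), s(v, b), s(v, c)} : Finset (Sym2 V))) with hDA
    set DB : Finset (Sym2 V) := ({s(v, a), s(v, b), s(v, c)} : Finset (Sym2 V)) with hDB
    have hD : ∀ e, e ∈ ((insert v C).biUnion fun v => ({s(v, a), s(v, b), s(v, c)} : Finset (Sym2 V))) ↔ e ∈ DA ∨ e ∈ DB := fun e => by
      rw [Finset.biUnion_insert, Finset.mem_union]; exact or_comm
    have hDBmem : ∀ e, e ∈ DB ↔ (e = s(v, a) ∨ e = s(v, b) ∨ e = s(v, c)) := fun e => by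
      simp only [hDB, Finset.mem_insert, Finset.mem_singleton]
    -- the pieces meet only in `{a, b, c}`
    have hsepD : ∀ x : V, (∃ e ∈ DA, x ∈ e) → (∃ e ∈ DB, x ∈ e) → (x = a ∨ x = b ∨ x = c) := by
      rintro x ⟨e, he, hxe⟩ ⟨e', he', hxe'⟩
      by_contra hx
      simp only [not_or] at hx
      have hxv : x = v := by
        rcases (hDBmem e').1 he' with rfl | rfl | rfl <;> rcases Sym2.mem_iff.1 hxe' with h | h <;>
          first | exact h | exact absurd h hx.1 | exact absurd h hx.2.1 | exact absurd h hx.2.2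
      subst hxv
      rw [hDA, Finset.mem_biUnion] at he
      obtain ⟨u, huC, heu⟩ := he
      have hxu : x = u := by
        simp only [Finset.mem_insert, Finset.mem_singleton] at heu
        rcases heu with rfl | rfl | rfl <;> rcases Sym2.mem_iff.1 hxe with h | h <;>
          first | exact h | exact absurd h hx.1 | exact absurd h hx.2.1 | exact absurd h hx.2.2
      exact hvC (hxu ▸ huC)
    -- the piece parameters
    have hwU : ∀ e, e ∉ (↑DA ∪ ↑DB : Set (Sym2 V)) → (w e : ℝ) = 0 := fun e he =>
      hw e (fun h => he (by rw [Set.mem_union, Finset.mem_coe, Finset.mem_coe]; exact (hD e).1 h))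
    have hA : ∀ e ∈ (↑DA : Set (Sym2 V)), (fun e => if e ∈ DA then w e else 0) e = w e := fun e he => by
      simp only [Finset.mem_coe] at he; simp only [if_pos he]
    have hA' : ∀ e ∉ (↑DA : Set (Sym2 V)), (fun e => if e ∈ DA then w e else 0) e = 0 := fun e he => by
      simp only [Finset.mem_coe] at he; simp only [if_neg he]
    have hB : ∀ e ∈ (↑DA : Set (Sym2 V)), (fun e => if e ∈ DA then (0 : unitInterval) else w e) e = 0 :=
      fun e he => by simp only [Finset.mem_coe] at he; simp only [if_pos he]
    have hB' : ∀ e ∉ (↑DA : Set (Sym2 V)), (fun e => if e ∈ DA then (0 : unitInterval) else w e) e = w e :=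
      fun e he => by simp only [Finset.mem_coe] at he; simp only [if_neg he]
    -- rows of piece A (induction) and of piece B (the claw)
    have hwA : ∀ e, e ∉ DA → (((fun e => if e ∈ DA then w e else 0) e : unitInterval) : ℝ) = 0 :=
      fun e he => by simp only [if_neg he]; rfl
    obtain ⟨r1A, lbA, lgA⟩ := ih haC' hbC' hcC' (fun e => if e ∈ DA then w e else 0) hwA
    have hwB : ∀ e, e ∉ (↑DB : Set (Sym2 V)) →
        (((fun e => if e ∈ DA then (0 : unitInterval) else w e) e : unitInterval) : ℝ) = 0 := by
      intro e he
      rw [Finset.mem_coe] at he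
      by_cases heA : e ∈ DA
      · simp only [if_pos heA]; rfl
      · simp only [if_neg heA]
        exact hw e (fun h => by rcases (hD e).1 h with h | h <;> [exact heA h; exact he h])
    have r1B := claw_r1 hab hac hbc hva hvb hvc hDBmem _ hq hwB
    have lbB := claw_lb hab hac hbc hva hvb hvc hDBmem _ hq hwB
    have lgB := claw_lg hab hac hbc hva hvb hvc hDBmem _ hq hwB
    exact ⟨r1_of_threeSum hab hac hbc hsepD hD w _ _ hq hwU hA hA' hB hB' r1A lbA lgA r1B lbB lgB,
      lb_of_threeSum hab hac hbc hsepD w _ _ hwU hA hA' hB hB' hq hD lbA lbB,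
      lg_of_threeSum hab hac hbc hsepD w _ _ hwU hA hA' hB hB' hq hD lgA lgB⟩

/-- **R1-RC on `K_{3,n}`, every `q > 0`**: `φ(T)·φ(S) ≤ φ(U_b)·φ(U_c)` for the free random-cluster measure of
any weighted graph all of whose pairs join `{a,b,c}` to centres in `C`. [this work] -/
theorem kThreeN_r1 (C : Finset V) (haC : a ∉ C) (hbC : b ∉ C) (hcC : c ∉ C) (w : Sym2 V → unitInterval)
    (hw : ∀ e, e ∉ (C.biUnion fun v => ({s(v, a), s(v, b), s(v, c)} : Finset (Sym2 V))) → (w e : ℝ) = 0) :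
    (rcMeasureW w q ∅).real {η : BondConfig V | b ∈ cl η.toFinset a ∧ c ∈ cl η.toFinset a} * (rcMeasureW w q ∅).real {η : BondConfig V | b ∉ cl η.toFinset a ∧ c ∉ cl η.toFinset a ∧ Sep (C.biUnion fun v => ({s(v, a), s(v, b), s(v, c)} : Finset (Sym2 V))) (cl η.toFinset a) b c} ≤ (rcMeasureW w q ∅).real {η : BondConfig V | b ∈ cl η.toFinset a ∧ c ∉ cl η.toFinset a} * (rcMeasureW w q ∅).real {η : BondConfig V | b ∉ cl η.toFinset a ∧ c ∈ cl η.toFinset a} :=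
  (kThreeN_rows hab hac hbc hq C haC hbC hcC w hw).1

end KThreeN

end ThreeSum

end Summit.CriticalPhenomena.PercolationContinuityZ3.Theorems
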